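import Summits.AtomisticToContinuum.Crystallization.Theses.ThreeConeCertificate
import Summits.AtomisticToContinuum.Crystallization.Theorems.ChargedEnergyGap.Negative.BlocksBound
import Summits.AtomisticToContinuum.Crystallization.Theorems.ChargedEnergyGap.Negative.Periodisation
import Summits.AtomisticToContinuum.Crystallization.Theorems.ExactCertificate.Negative.SplitBasics

/-!
# `ExactCertificate` (stmt-AtomisticToContinuum-11959), line `closure-makes-nogap-exact`:
# complementary slackness of a witness, I — slacks along blocks and `U = 0` on `D_P`

Support file for the crux `ThreeConeCertificate.ExactCertificate` (line lead, necessity side of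
the registered stub `stub_noGap`).  For a three-cone split `IsSplit ρ c g U f` (file
`ExactCertificate/Negative/SplitBasics`) whose value attains a periodic configuration,
`c + f 0 / 2 ≤ −e(P)`, we prove:

* `witness_eq` : `e(P) = e*` and `c + f 0/2 = −e*`;
* `slacks_le` : along the `K`-blocks of `P` the three slacks
  `(E_g + c·N) + E_U + (E_f + N·f 0/2)` are eventually `≤ ε·N` (each bracket is `≥ 0`), whence the
  individual `g_slack_le`, `U_slack_le`;
* `sub_mul_le_two_mul_energy` : pair counting in blocks — a distance of `P` is realised
  `≥ K³ − 6MK²` times among ordered pairs of the `K`-block;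
* `U_eq_zero_of_mem_points` : **`U = 0` on every distance realised by `P`**, and hence
  `f_eq_lennardJones_of_mem_points` : **`f = V_LJ` on `D_P ∩ [ρ,∞)`**.

All `[folklore]`; adapted from the crux workfile `Cruxes/ExactCertificate/Disproof.lean` §2, §4
(refuter, cdisprove seat), re-proved here against the importable `Theorems` API so that the
necessity theorem `ExactCertificate → stub_noGap` (file `…NoGapNecessary`) can use it.
-/

noncomputable section

namespace Summit.AtomisticToContinuum.Crystallization.Theorems.ThreeConeCertificateExactCertificate.Slackness

open Literature.MathematicalPhysics.StatisticalMechanics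
open Summit.AtomisticToContinuum.Crystallization.Theses.ThreeConeCertificate
open Summit.AtomisticToContinuum.Crystallization.Theorems.ChargedEnergyGapNegative
  (E3 eStar card_mul_eStar_le_interactionEnergy bddBelow_energyPerParticle_lennardJones
    exists_trialState eStar_le)
open Summit.AtomisticToContinuum.Crystallization.Theorems.ChargedEnergyGapNegative.Blocks
  (BIdx bpt bpt_injective blockConfig blockConfig_apply blockConfig_injective card_BIdx latVec
    latVec_add exists_latVec_eq coords IsDeep card_not_deep_le exists_block_energy_le)
open Summit.AtomisticToContinuum.Crystallization.Theorems.ExactCertificateNegative (IsSplit)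
open scoped BigOperators

/-- **For a witness, `e(P) = e*` and `c + f 0/2 = −e*`** — already when (S6) is weakened to `≤`
(value floor `−e* ≤ c + f 0/2` against `e* ≤ e(P)`). [folklore] -/
theorem witness_eq {P : PeriodicConfiguration 3} {ρ c : ℝ} {g U f : ℝ → ℝ} (h : IsSplit ρ c g U f)
    (hv : c + f 0 / 2 ≤ -(P.energyPerParticle lennardJones)) :
    P.energyPerParticle lennardJones = eStar ∧ c + f 0 / 2 = -eStar := by
  have h1 := h.value_ge
  have h2 := eStar_le P
  constructor <;> linarith

/-- **The three slacks of a witness are `o(N)` along the `K`-blocks of `P`**: for every `ε > 0`,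
eventually `(E_g + c·N) + E_U + (E_f + N·f 0/2) ≤ ε·N` on the block configuration of `N = #F·K³`
points (blocks are trial states: `E_LJ(block) ≤ N·(e(P) + ε)`). [folklore] -/
theorem slacks_le {P : PeriodicConfiguration 3} {ρ c : ℝ} {g U f : ℝ → ℝ} (h : IsSplit ρ c g U f)
    (hv : c + f 0 / 2 ≤ -(P.energyPerParticle lennardJones)) {ε : ℝ} (hε : 0 < ε) :
    ∃ K₀ : ℕ, 0 < K₀ ∧ ∀ K : ℕ, K₀ ≤ K →
      (interactionEnergy g (blockConfig P K) + c * Fintype.card (BIdx P K)) +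
        interactionEnergy U (blockConfig P K) +
        (interactionEnergy f (blockConfig P K) + Fintype.card (BIdx P K) * f 0 / 2) ≤
      ε * Fintype.card (BIdx P K) := by
  obtain ⟨K₀, hK₀, hK⟩ := exists_block_energy_le P hε
  refine ⟨K₀, hK₀, fun K hKK => ?_⟩
  have h1 := hK K hKK
  rw [h.energy_eq (blockConfig_injective P K)] at h1
  have h3 : P.energyPerParticle lennardJones = -(c + f 0 / 2) := by
    have := (witness_eq h hv).1
    have := (witness_eq h hv).2
    linarith
  rw [h3] at h1
  nlinarith [h1]

/-- The `g`-slack alone: **`P` is asymptotically a per-particle ground state of `g` with energy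
`−c`**. [folklore] -/
theorem g_slack_le {P : PeriodicConfiguration 3} {ρ c : ℝ} {g U f : ℝ → ℝ} (h : IsSplit ρ c g U f)
    (hv : c + f 0 / 2 ≤ -(P.energyPerParticle lennardJones)) {ε : ℝ} (hε : 0 < ε) :
    ∃ K₀ : ℕ, 0 < K₀ ∧ ∀ K : ℕ, K₀ ≤ K →
      interactionEnergy g (blockConfig P K) + c * Fintype.card (BIdx P K) ≤
        ε * Fintype.card (BIdx P K) := by
  obtain ⟨K₀, hK₀, hK⟩ := slacks_le h hv hε
  refine ⟨K₀, hK₀, fun K hKK => ?_⟩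
  have h1 := hK K hKK
  have h2 := h.U_energy_nonneg (blockConfig_injective P K)
  have h3 := h.f_energy_ge (blockConfig P K)
  linarith

/-- The `U`-slack alone: **the slack cone is asymptotically empty on `P`**. [folklore] -/
theorem U_slack_le {P : PeriodicConfiguration 3} {ρ c : ℝ} {g U f : ℝ → ℝ} (h : IsSplit ρ c g U f)
    (hv : c + f 0 / 2 ≤ -(P.energyPerParticle lennardJones)) {ε : ℝ} (hε : 0 < ε) :
    ∃ K₀ : ℕ, 0 < K₀ ∧ ∀ K : ℕ, K₀ ≤ K →
      interactionEnergy U (blockConfig P K) ≤ ε * Fintype.card (BIdx P K) := by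
  obtain ⟨K₀, hK₀, hK⟩ := slacks_le h hv hε
  refine ⟨K₀, hK₀, fun K hKK => ?_⟩
  have h1 := hK K hKK
  have h2 := h.stable _ _ (blockConfig_injective P K)
  have h3 := h.f_energy_ge (blockConfig P K)
  linarith

/-- **Pair counting in blocks**: a distance `d = dist p q` realised by two points of `P` is
realised at least `K³ − 6MK²` times (once per `M`-deep lattice coordinate) among ordered pairs of
the `K`-block, so for a potential `W ≥ 0` on `(0,∞)`:
`(K³ − 6MK²)·W(d) ≤ 2·E_W(block_K)`. [folklore] -/
theorem sub_mul_le_two_mul_energy (P : PeriodicConfiguration 3) {W : ℝ → ℝ}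
    (hW : ∀ r, 0 < r → 0 ≤ W r) {p q : E3} (hp : p ∈ P.points) (hq : q ∈ P.points)
    (hpq : p ≠ q) :
    ∃ M : ℕ, ∀ K : ℕ, ((K : ℝ) ^ 3 - 6 * M * (K : ℝ) ^ 2) * W (dist p q) ≤
      2 * interactionEnergy W (blockConfig P K) := by
  classical
  obtain ⟨x, hx, g₁, hg₁, rfl⟩ := hp
  obtain ⟨x', hx', g₂, hg₂, rfl⟩ := hq
  obtain ⟨Δ, hΔ⟩ := exists_latVec_eq P (P.lattice.sub_mem hg₂ hg₁)
  set M : ℕ := ∑ i, (Δ i).natAbs with hM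
  have hΔM : ∀ i, ((Δ i).natAbs : ℤ) ≤ M := fun i => by
    have : (Δ i).natAbs ≤ M :=
      Finset.single_le_sum (f := fun j => (Δ j).natAbs) (fun j _ => Nat.zero_le _)
        (Finset.mem_univ i)
    exact_mod_cast this
  refine ⟨M, fun K => ?_⟩
  set d : ℝ := dist (x + g₁) (x' + g₂) with hd
  have hdpos : 0 < d := dist_pos.2 hpq
  have hWd : 0 ≤ W d := hW d hdpos
  -- deep coordinates and their shifts by `Δ`
  set D : Finset (Fin 3 → Fin K) := Finset.univ.filter fun k => IsDeep K M k with hD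
  let sh : (Fin 3 → Fin K) → (Fin 3 → Fin K) := fun k i =>
    ⟨(((k i : ℕ) : ℤ) + Δ i).toNat % K, Nat.mod_lt _ (k i).pos⟩
  have hsh : ∀ k, IsDeep K M k → ∀ i, ((sh k i : ℕ) : ℤ) = ((k i : ℕ) : ℤ) + Δ i := by
    intro k hk i
    have h1 := (hk i).1
    have h2 := (hk i).2
    have h3 := hΔM i
    have h4 : ((Δ i).natAbs : ℤ) = |Δ i| := Int.natCast_natAbs (Δ i)
    have h5 : -((Δ i).natAbs : ℤ) ≤ Δ i ∧ Δ i ≤ ((Δ i).natAbs : ℤ) := by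
      rw [h4]; exact abs_le.1 le_rfl
    have hnn : 0 ≤ ((k i : ℕ) : ℤ) + Δ i := by omega
    have hlt : ((((k i : ℕ) : ℤ) + Δ i).toNat) < K := by omega
    show (((((k i : ℕ) : ℤ) + Δ i).toNat % K : ℕ) : ℤ) = _
    rw [Nat.mod_eq_of_lt hlt]
    omega
  have hcoords : ∀ k, IsDeep K M k → coords K (sh k) = coords K k + Δ := by
    intro k hk
    funext i
    simp only [coords, Pi.add_apply]
    exact hsh k hk i
  -- the partner of the block point `(x, k)` is `(x', sh k)`, at distance exactly `d`
  have hpartner : ∀ k, IsDeep K M k →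
      dist (bpt P K (⟨x, hx⟩, k)) (bpt P K (⟨x', hx'⟩, sh k)) = d := by
    intro k hk
    have h1 : bpt P K (⟨x', hx'⟩, sh k) = bpt P K (⟨x, hx⟩, k) + ((x' + g₂) - (x + g₁)) := by
      simp only [bpt, hcoords k hk, latVec_add, hΔ]
      abel
    rw [h1, hd, dist_eq_norm, dist_eq_norm, sub_add_cancel_left, norm_neg]
    exact norm_sub_rev _ _
  -- rows of the double sum
  set e := Fintype.equivFin (BIdx P K) with he
  set T : Finset (Fin (Fintype.card (BIdx P K))) := D.image fun k => e (⟨x, hx⟩, k) with hT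
  have hTcard : T.card = D.card := by
    rw [hT, Finset.card_image_of_injective]
    intro k k' h
    have := e.injective h
    simpa using this
  have hrow_nonneg : ∀ a, 0 ≤ siteEnergy W (blockConfig P K) a := by
    intro a
    refine Finset.sum_nonneg fun b hb => hW _ (dist_pos.2 fun heq => ?_)
    exact (Finset.ne_of_mem_erase hb) ((blockConfig_injective P K) heq).symm
  have hrow : ∀ a ∈ T, W d ≤ siteEnergy W (blockConfig P K) a := by
    intro a ha
    obtain ⟨k, hk, rfl⟩ := Finset.mem_image.1 ha
    have hkD : IsDeep K M k := (Finset.mem_filter.1 hk).2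
    set b := e (⟨x', hx'⟩, sh k) with hb
    have hdist : dist (blockConfig P K (e (⟨x, hx⟩, k))) (blockConfig P K b) = d := by
      simp only [blockConfig_apply, hb, he, Equiv.symm_apply_apply]
      exact hpartner k hkD
    have hba : b ∈ Finset.univ.erase (e (⟨x, hx⟩, k)) := by
      refine Finset.mem_erase.2 ⟨fun hbe => ?_, Finset.mem_univ _⟩
      have : d = 0 := by rw [← hdist, hbe, dist_self]
      exact hdpos.ne' this
    calc W d = W (dist (blockConfig P K (e (⟨x, hx⟩, k))) (blockConfig P K b)) := by rw [hdist]
      _ ≤ siteEnergy W (blockConfig P K) (e (⟨x, hx⟩, k)) :=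
        Finset.single_le_sum (f := fun b => W (dist (blockConfig P K (e (⟨x, hx⟩, k)))
          (blockConfig P K b))) (fun b hb' => hW _ (dist_pos.2 fun heq =>
            (Finset.ne_of_mem_erase hb') ((blockConfig_injective P K) heq).symm)) hba
  -- counting deep coordinates
  have hDcard : (K : ℝ) ^ 3 - 6 * M * (K : ℝ) ^ 2 ≤ D.card := by
    have h1 := card_not_deep_le K M
    have h2 := Finset.card_filter_add_card_filter_not (s := Finset.univ)
      (p := fun k : Fin 3 → Fin K => IsDeep K M k)
    simp only [Finset.card_univ, Fintype.card_fun, Fintype.card_fin] at h2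
    have h3 : (D.card : ℝ) + ((Finset.univ.filter fun k : Fin 3 → Fin K => ¬ IsDeep K M k).card : ℝ)
        = (K : ℝ) ^ 3 := by exact_mod_cast h2
    have h4 : ((Finset.univ.filter fun k : Fin 3 → Fin K => ¬ IsDeep K M k).card : ℝ) ≤
        6 * M * (K : ℝ) ^ 2 := by exact_mod_cast h1
    linarith
  -- assemble
  calc ((K : ℝ) ^ 3 - 6 * M * (K : ℝ) ^ 2) * W d ≤ D.card * W d :=
        mul_le_mul_of_nonneg_right hDcard hWd
    _ = ∑ _a ∈ T, W d := by rw [Finset.sum_const, nsmul_eq_mul, hTcard]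
    _ ≤ ∑ a ∈ T, siteEnergy W (blockConfig P K) a := Finset.sum_le_sum hrow
    _ ≤ ∑ a, siteEnergy W (blockConfig P K) a :=
        Finset.sum_le_sum_of_subset_of_nonneg (Finset.subset_univ T) fun a _ _ => hrow_nonneg a
    _ = 2 * interactionEnergy W (blockConfig P K) := (two_mul_interactionEnergy W _).symm

/-- **COMPLEMENTARY SLACKNESS FOR THE SLACK CONE: `U = 0` on `D_P`** — for a witness, the slack
`U` vanishes at every distance realised by two points of `P` (pair counting in blocks against the
`U`-slack `o(N)`). [folklore] -/
theorem U_eq_zero_of_mem_points {P : PeriodicConfiguration 3} {ρ c : ℝ} {g U f : ℝ → ℝ}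
    (h : IsSplit ρ c g U f) (hv : c + f 0 / 2 ≤ -(P.energyPerParticle lennardJones))
    {p q : E3} (hp : p ∈ P.points) (hq : q ∈ P.points) (hpq : p ≠ q) :
    U (dist p q) = 0 := by
  have hd : 0 < dist p q := dist_pos.2 hpq
  have hU0 : 0 ≤ U (dist p q) := h.U_nonneg _ hd
  refine le_antisymm (le_of_forall_pos_le_add fun ε hε => ?_) hU0
  obtain ⟨M, hM⟩ := sub_mul_le_two_mul_energy P h.U_nonneg hp hq hpq
  set F : ℝ := (P.motif.card : ℝ) with hFdef
  have hF : 0 < F := by rw [hFdef]; exact_mod_cast P.motif_nonempty.card_pos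
  obtain ⟨K₀, -, hK⟩ := U_slack_le h hv (show 0 < ε / (4 * F) by positivity)
  set K : ℕ := max K₀ (12 * M + 12) with hKdef
  have h1 := hM K
  have h2 := hK K (le_max_left _ _)
  have hcard : ((Fintype.card (BIdx P K) : ℕ) : ℝ) = F * (K : ℝ) ^ 3 := by
    rw [card_BIdx]; push_cast; rw [hFdef]
  rw [hcard] at h2
  have hK12 : (12 * M + 12 : ℝ) ≤ K := by
    have : 12 * M + 12 ≤ K := le_max_right _ _
    exact_mod_cast this
  have hM0 : (0 : ℝ) ≤ M := Nat.cast_nonneg M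
  have hKpos : (0 : ℝ) < K := by linarith
  have hK3 : (0 : ℝ) < (K : ℝ) ^ 3 := by positivity
  have hhalf : (K : ℝ) ^ 3 / 2 ≤ (K : ℝ) ^ 3 - 6 * M * (K : ℝ) ^ 2 := by
    have e1 : (K : ℝ) ^ 3 - 6 * M * (K : ℝ) ^ 2 - (K : ℝ) ^ 3 / 2 =
        (K : ℝ) ^ 2 * ((K : ℝ) / 2 - 6 * M) := by ring
    have e2 : (0 : ℝ) ≤ (K : ℝ) ^ 2 * ((K : ℝ) / 2 - 6 * M) :=
      mul_nonneg (sq_nonneg _) (by linarith)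
    linarith
  have h3 : (K : ℝ) ^ 3 / 2 * U (dist p q) ≤ 2 * interactionEnergy U (blockConfig P K) :=
    (mul_le_mul_of_nonneg_right hhalf hU0).trans h1
  have h4 : 2 * interactionEnergy U (blockConfig P K) ≤ ε * (K : ℝ) ^ 3 / 2 := by
    have : ε / (4 * F) * (F * (K : ℝ) ^ 3) = ε * (K : ℝ) ^ 3 / 4 := by
      field_simp
    nlinarith [h2, this]
  have h5 : (K : ℝ) ^ 3 / 2 * U (dist p q) ≤ (K : ℝ) ^ 3 / 2 * ε := by nlinarith
  have h6 := le_of_mul_le_mul_left h5 (by positivity : (0 : ℝ) < (K : ℝ) ^ 3 / 2)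
  linarith

/-- Hence **`f` INTERPOLATES `V_LJ` ON `D_P ∩ [ρ,∞)`**: `f = V_LJ` at every distance `≥ ρ`
realised in `P` (while `f ≤ V_LJ` on the whole tail, `IsSplit.f_le_tail`). [folklore] -/
theorem f_eq_lennardJones_of_mem_points {P : PeriodicConfiguration 3} {ρ c : ℝ} {g U f : ℝ → ℝ}
    (h : IsSplit ρ c g U f) (hv : c + f 0 / 2 ≤ -(P.energyPerParticle lennardJones))
    {p q : E3} (hp : p ∈ P.points) (hq : q ∈ P.points) (hpq : p ≠ q) (hρ : ρ ≤ dist p q) :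
    f (dist p q) = lennardJones (dist p q) := by
  rw [h.f_eq_tail hρ (dist_pos.2 hpq), U_eq_zero_of_mem_points h hv hp hq hpq, sub_zero]

/-- **Registered stub `stub_contact` of the line `closure-makes-nogap-exact`** (signature verbatim):
complementary slackness on the distance set of a witness. [folklore] -/
theorem stub_contact : ∀ (P : PeriodicConfiguration 3) (ρ c : ℝ) (g U f : ℝ → ℝ),
    IsSplit ρ c g U f → c + f 0 / 2 ≤ -(P.energyPerParticle lennardJones) →
    ∀ p ∈ P.points, ∀ q ∈ P.points, p ≠ q →
      U (dist p q) = 0 ∧ (ρ ≤ dist p q → f (dist p q) = lennardJones (dist p q)) :=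
  fun _ _ _ _ _ _ h hv _ hp _ hq hpq =>
    ⟨U_eq_zero_of_mem_points h hv hp hq hpq, fun hρ => f_eq_lennardJones_of_mem_points h hv hp hq hpq hρ⟩

end Summit.AtomisticToContinuum.Crystallization.Theorems.ThreeConeCertificateExactCertificate.Slackness

end
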